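import Summits.QuantumFields.YangMills.Theorems.LangevinControlUVFemtoCurvatureTwoPointCDefsSplit

/-!
# Route `LangevinControlUV`, crux `FemtoCurvatureTwoPointC` (stmt-QuantumFields-16204): vocabulary of line `Sketch`, IV — the interior profiles

Part IV of the route-posited statements of the skeleton `Cruxes/FemtoCurvatureTwoPointC/Lines/Sketch.lean` (continuation lead
`prover-line-stmt-QuantumFields-16204-c4-0`, reshape v6; parts I–III are `…CDefs.lean`, `…CDefsProfiles.lean`, `…CDefsSplit.lean`,
same namespace, which see for the conventions: NOTHING here is asserted; the `def`s below are line statements consumed by the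
bridge `afProfilesBigAt_of_afProfilesCoreAt` of the companion file `…FemtoCurvatureTwoPointCCoreBridge.lean`).

The point of v6. In `AFProfilesBigAt r` (v5) the two UPPER profile clauses — transverse `s⁸ f_L(s) ≤ C·u(max 8 (min L (8s)),β)²`
and longitudinal `s⁸ |g_L(s)| ≤ C·u(…)²`, `f_L(s) = Cov_{L,β}(P_0^{01},P_{se₂}^{01})`, `g_L(s) = Cov_{L,β}(P_0^{01},P_{se₀}^{01})` —
are demanded for every separation up to half the box, `2s ≤ L`. By REFLECTION POSITIVITY both profiles are non-negative and
non-increasing on `1 ≤ s ≤ L/2` for every compact `G`, every continuous `ρ`, every torus and every `β ≥ 0` (transverse: landed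
`FemtoCurvatureTwoPoint.stub_axisCovNonneg`, `…stub_axisProfileAntitone`, p-family of stmt-9363; longitudinal: this reshape,
`…CStubLongCovNonnegSymm`, `…CStubLongLogConvex`, `…CStubAntitoneOfLogConvex` — link mirror for odd centres, site mirror for even
centres, odd tori by the odd-torus mirror and `s ↦ L − s`). Hence on a window box the upper clauses in the TOP range
`L/8 < s ≤ L/2` follow from the same clauses at `s₀ = ⌊L/8⌋` (antitonicity, `(s/s₀)⁸ < 8⁸`, and one octave of in-window
comparability `u(8s₀,β)² ≤ 4·u(L,β)²`, landed `stub_windowRatio`). So the femto-engine statement only needs its upper profile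
clauses in the crux's own INTERIOR range `8s ≤ L`:

* `AFProfilesCoreAt r` — `AFProfilesBigAt r` character for character EXCEPT that the transverse-upper and longitudinal-upper
  clauses are demanded for `1 ≤ s`, `8s ≤ L` only, with target `C·u(8s,β)²` (`= C·u(max 8 (min L (8s)),β)²` there).

Every matching clause of the promoted physics item then lives at separations `≤ L/8`, a factor `8` below the box scale, where
zero-mode / periodicity-image contributions are `O(8⁻⁸)` relative; the top of the box is paid for by reflection positivity.
Refs: `Cruxes/FemtoCurvatureTwoPointC/NOTES.md` (cycle 6).
-/

set_option autoImplicit false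

noncomputable section

open Filter Topology MeasureTheory
open Literature.MathematicalPhysics.QuantumFieldTheory

namespace Summit.QuantumFields.YangMills.Theorems.FemtoCurvatureTwoPointC

/-- **AF profiles on femto boxes, INTERIOR separations, at fixed data `(G, r)` — the femto-engine statement of line `Sketch`
after reshape v6 (OPEN; crux-sized).** Exactly `AFProfilesBigAt r` (admissibility `u > 0`, `β ↦ u L β` continuous on `[β₀,∞)`,
`u L β → 0`; bare size `c₈ ≤ β·u(8,β)`; in-window comparability; the two-sided averaged dyadic asymptotic-freedom step law;
transverse lower `c·u(8n,β)² ≤ n⁸ f_L(n)` for `1 ≤ n`, `8n ≤ L`; variance ceiling `Var_{L,β}(P_0^{01}) ≤ C·u(8,β)²`; all matching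
clauses on window boxes `8 ≤ L` only) EXCEPT that the transverse upper clause `s⁸ f_L(s) ≤ C·u(8s,β)²` and the longitudinal upper
clause `s⁸ |g_L(s)| ≤ C·u(8s,β)²` are demanded only for `1 ≤ s`, `8s ≤ L` (v5: `2s ≤ L`, target `C·u(max 8 (min L (8s)),β)²`).
Window of box `L`: every sub-box `8 ≤ M ≤ L` has `u M β ≤ u₀`. Content: Bałaban-class ultraviolet stability WITH a dimension-8
observable along femto trajectories, at separations a factor `8` inside the box — not in print. -/
def AFProfilesCoreAt {G : Type} [Group G] [TopologicalSpace G] [IsTopologicalGroup G] [CompactSpace G]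
    [MeasurableSpace G] [BorelSpace G] (r : LatticeRep G) : Prop :=
  ∃ (u : ℕ → ℝ → ℝ) (u₀ β₀ κ₁ κ₂ κ₃ c C c₈ : ℝ),
    0 < u₀ ∧ 0 < c ∧ 0 < κ₁ ∧ 0 ≤ κ₃ ∧ 0 < c₈ ∧
    (∀ (L : ℕ) (β : ℝ), 8 ≤ L → β₀ ≤ β → 0 < u L β) ∧
    (∀ L : ℕ, 8 ≤ L → ContinuousOn (u L) (Set.Ici β₀)) ∧
    (∀ L : ℕ, 8 ≤ L → Filter.Tendsto (u L) Filter.atTop (nhds 0)) ∧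
    (∀ β : ℝ, β₀ ≤ β → c₈ ≤ β * u 8 β) ∧
    (∀ (L L' : ℕ) (β : ℝ), β₀ ≤ β → 8 ≤ L → L ≤ L' → L' ≤ 2 * L →
        (∀ M : ℕ, 8 ≤ M → M ≤ L → u M β ≤ u₀) → |(u L β)⁻¹ - (u L' β)⁻¹| ≤ κ₂) ∧
    (∀ (k m : ℕ) (β : ℝ), β₀ ≤ β → (∀ M : ℕ, 8 ≤ M → M ≤ 8 * 2 ^ (k + m) → u M β ≤ u₀) →
        κ₁ * m - κ₃ ≤ (u (8 * 2 ^ k) β)⁻¹ - (u (8 * 2 ^ (k + m)) β)⁻¹ ∧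
          (u (8 * 2 ^ k) β)⁻¹ - (u (8 * 2 ^ (k + m)) β)⁻¹ ≤ κ₂ * m + κ₃) ∧
    (∀ (L : ℕ) [NeZero L] (β : ℝ) (n : ℕ), β₀ ≤ β → 1 ≤ n → 8 * n ≤ L →
        (∀ M : ℕ, 8 ≤ M → M ≤ L → u M β ≤ u₀) →
        ∀ (P : (Fin 4 → ZMod L) → Fin 4 → Fin 4 → GaugeConfig 4 L G → ℝ)
          (E : (GaugeConfig 4 L G → ℝ) → ℝ),
          (P = fun x i j U => (r.N : ℝ) - (r.ρ (plaquetteHolonomy U x i j)).trace.re) →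
          (E = fun F => wilsonExpectation r.ρ β F) →
          c * u (8 * n) β ^ 2 ≤
            (n : ℝ) ^ 8 * (E (fun U => P 0 0 1 U * P (Pi.single (2 : Fin 4) ((n : ℕ) : ZMod L)) 0 1 U)
              - E (P 0 0 1) * E (P (Pi.single (2 : Fin 4) ((n : ℕ) : ZMod L)) 0 1))) ∧
    (∀ (L : ℕ) [NeZero L] (β : ℝ) (s : ℕ), β₀ ≤ β → 8 ≤ L → 1 ≤ s → 8 * s ≤ L →
        (∀ M : ℕ, 8 ≤ M → M ≤ L → u M β ≤ u₀) →
        ∀ (P : (Fin 4 → ZMod L) → Fin 4 → Fin 4 → GaugeConfig 4 L G → ℝ)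
          (E : (GaugeConfig 4 L G → ℝ) → ℝ),
          (P = fun x i j U => (r.N : ℝ) - (r.ρ (plaquetteHolonomy U x i j)).trace.re) →
          (E = fun F => wilsonExpectation r.ρ β F) →
          (s : ℝ) ^ 8 * (E (fun U => P 0 0 1 U * P (Pi.single (2 : Fin 4) ((s : ℕ) : ZMod L)) 0 1 U)
              - E (P 0 0 1) * E (P (Pi.single (2 : Fin 4) ((s : ℕ) : ZMod L)) 0 1)) ≤
            C * u (8 * s) β ^ 2) ∧
    (∀ (L : ℕ) [NeZero L] (β : ℝ) (s : ℕ), β₀ ≤ β → 8 ≤ L → 1 ≤ s → 8 * s ≤ L →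
        (∀ M : ℕ, 8 ≤ M → M ≤ L → u M β ≤ u₀) →
        ∀ (P : (Fin 4 → ZMod L) → Fin 4 → Fin 4 → GaugeConfig 4 L G → ℝ)
          (E : (GaugeConfig 4 L G → ℝ) → ℝ),
          (P = fun x i j U => (r.N : ℝ) - (r.ρ (plaquetteHolonomy U x i j)).trace.re) →
          (E = fun F => wilsonExpectation r.ρ β F) →
          (s : ℝ) ^ 8 * |E (fun U => P 0 0 1 U * P (Pi.single (0 : Fin 4) ((s : ℕ) : ZMod L)) 0 1 U)
              - E (P 0 0 1) * E (P (Pi.single (0 : Fin 4) ((s : ℕ) : ZMod L)) 0 1)| ≤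
            C * u (8 * s) β ^ 2) ∧
    (∀ (L : ℕ) [NeZero L] (β : ℝ), β₀ ≤ β → 8 ≤ L → (∀ M : ℕ, 8 ≤ M → M ≤ L → u M β ≤ u₀) →
        ∀ (P : (Fin 4 → ZMod L) → Fin 4 → Fin 4 → GaugeConfig 4 L G → ℝ)
          (E : (GaugeConfig 4 L G → ℝ) → ℝ),
          (P = fun x i j U => (r.N : ℝ) - (r.ρ (plaquetteHolonomy U x i j)).trace.re) →
          (E = fun F => wilsonExpectation r.ρ β F) →
          E (fun U => P 0 0 1 U * P 0 0 1 U) - E (P 0 0 1) * E (P 0 0 1) ≤ C * u 8 β ^ 2)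

/-- **AF profiles on femto boxes, interior separations (universal closure)**: for every compact simple `G` (any Borel structure)
and faithful unitary `r`, `AFProfilesCoreAt r`. Registered stub `stub_afProfilesCore` of line `Sketch` (skeleton v6), by name
(`afProfilesCore_iff_stub`). OPEN — the femto continuum limit with a dimension-8 observable, boxes `L ≥ 8`, separations `≤ L/8`. -/
def AFProfilesCore : Prop :=
  ∀ (G : Type) [Group G] [TopologicalSpace G] [IsTopologicalGroup G] [CompactSpace G]
    [MeasurableSpace G] [BorelSpace G], IsCompactSimpleLieGroup G →
    ∀ r : LatticeRep G, AFProfilesCoreAt r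

/-- `AFProfilesCore` is, definitionally, the registered stub signature of `stub_afProfilesCore` (line `Sketch`, skeleton v6,
crux stmt-QuantumFields-16204). -/
theorem afProfilesCore_iff_stub :
    AFProfilesCore ↔
      ∀ (G : Type) [Group G] [TopologicalSpace G] [IsTopologicalGroup G] [CompactSpace G]
        [MeasurableSpace G] [BorelSpace G], IsCompactSimpleLieGroup G →
        ∀ r : LatticeRep G, ∃ (u : ℕ → ℝ → ℝ) (u₀ β₀ κ₁ κ₂ κ₃ c C c₈ : ℝ),
          0 < u₀ ∧ 0 < c ∧ 0 < κ₁ ∧ 0 ≤ κ₃ ∧ 0 < c₈ ∧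
          (∀ (L : ℕ) (β : ℝ), 8 ≤ L → β₀ ≤ β → 0 < u L β) ∧
          (∀ L : ℕ, 8 ≤ L → ContinuousOn (u L) (Set.Ici β₀)) ∧
          (∀ L : ℕ, 8 ≤ L → Filter.Tendsto (u L) Filter.atTop (nhds 0)) ∧
          (∀ β : ℝ, β₀ ≤ β → c₈ ≤ β * u 8 β) ∧
          (∀ (L L' : ℕ) (β : ℝ), β₀ ≤ β → 8 ≤ L → L ≤ L' → L' ≤ 2 * L →
              (∀ M : ℕ, 8 ≤ M → M ≤ L → u M β ≤ u₀) → |(u L β)⁻¹ - (u L' β)⁻¹| ≤ κ₂) ∧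
          (∀ (k m : ℕ) (β : ℝ), β₀ ≤ β → (∀ M : ℕ, 8 ≤ M → M ≤ 8 * 2 ^ (k + m) → u M β ≤ u₀) →
              κ₁ * m - κ₃ ≤ (u (8 * 2 ^ k) β)⁻¹ - (u (8 * 2 ^ (k + m)) β)⁻¹ ∧
                (u (8 * 2 ^ k) β)⁻¹ - (u (8 * 2 ^ (k + m)) β)⁻¹ ≤ κ₂ * m + κ₃) ∧
          (∀ (L : ℕ) [NeZero L] (β : ℝ) (n : ℕ), β₀ ≤ β → 1 ≤ n → 8 * n ≤ L →
              (∀ M : ℕ, 8 ≤ M → M ≤ L → u M β ≤ u₀) →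
              ∀ (P : (Fin 4 → ZMod L) → Fin 4 → Fin 4 → GaugeConfig 4 L G → ℝ)
                (E : (GaugeConfig 4 L G → ℝ) → ℝ),
                (P = fun x i j U => (r.N : ℝ) - (r.ρ (plaquetteHolonomy U x i j)).trace.re) →
                (E = fun F => wilsonExpectation r.ρ β F) →
                c * u (8 * n) β ^ 2 ≤
                  (n : ℝ) ^ 8 * (E (fun U => P 0 0 1 U * P (Pi.single (2 : Fin 4) ((n : ℕ) : ZMod L)) 0 1 U)
                    - E (P 0 0 1) * E (P (Pi.single (2 : Fin 4) ((n : ℕ) : ZMod L)) 0 1))) ∧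
          (∀ (L : ℕ) [NeZero L] (β : ℝ) (s : ℕ), β₀ ≤ β → 8 ≤ L → 1 ≤ s → 8 * s ≤ L →
              (∀ M : ℕ, 8 ≤ M → M ≤ L → u M β ≤ u₀) →
              ∀ (P : (Fin 4 → ZMod L) → Fin 4 → Fin 4 → GaugeConfig 4 L G → ℝ)
                (E : (GaugeConfig 4 L G → ℝ) → ℝ),
                (P = fun x i j U => (r.N : ℝ) - (r.ρ (plaquetteHolonomy U x i j)).trace.re) →
                (E = fun F => wilsonExpectation r.ρ β F) →
                (s : ℝ) ^ 8 * (E (fun U => P 0 0 1 U * P (Pi.single (2 : Fin 4) ((s : ℕ) : ZMod L)) 0 1 U)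
                    - E (P 0 0 1) * E (P (Pi.single (2 : Fin 4) ((s : ℕ) : ZMod L)) 0 1)) ≤
                  C * u (8 * s) β ^ 2) ∧
          (∀ (L : ℕ) [NeZero L] (β : ℝ) (s : ℕ), β₀ ≤ β → 8 ≤ L → 1 ≤ s → 8 * s ≤ L →
              (∀ M : ℕ, 8 ≤ M → M ≤ L → u M β ≤ u₀) →
              ∀ (P : (Fin 4 → ZMod L) → Fin 4 → Fin 4 → GaugeConfig 4 L G → ℝ)
                (E : (GaugeConfig 4 L G → ℝ) → ℝ),
                (P = fun x i j U => (r.N : ℝ) - (r.ρ (plaquetteHolonomy U x i j)).trace.re) →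
                (E = fun F => wilsonExpectation r.ρ β F) →
                (s : ℝ) ^ 8 * |E (fun U => P 0 0 1 U * P (Pi.single (0 : Fin 4) ((s : ℕ) : ZMod L)) 0 1 U)
                    - E (P 0 0 1) * E (P (Pi.single (0 : Fin 4) ((s : ℕ) : ZMod L)) 0 1)| ≤
                  C * u (8 * s) β ^ 2) ∧
          (∀ (L : ℕ) [NeZero L] (β : ℝ), β₀ ≤ β → 8 ≤ L → (∀ M : ℕ, 8 ≤ M → M ≤ L → u M β ≤ u₀) →
              ∀ (P : (Fin 4 → ZMod L) → Fin 4 → Fin 4 → GaugeConfig 4 L G → ℝ)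
                (E : (GaugeConfig 4 L G → ℝ) → ℝ),
                (P = fun x i j U => (r.N : ℝ) - (r.ρ (plaquetteHolonomy U x i j)).trace.re) →
                (E = fun F => wilsonExpectation r.ρ β F) →
                E (fun U => P 0 0 1 U * P 0 0 1 U) - E (P 0 0 1) * E (P 0 0 1) ≤ C * u 8 β ^ 2) :=
  Iff.rfl

end Summit.QuantumFields.YangMills.Theorems.FemtoCurvatureTwoPointC

end
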